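import Literature.Probability.RandomPlanarGeometry.LSW2004USTRado
import Literature.Probability.RandomPlanarGeometry.LoewnerCurveLimitDomain
import Literature.Probability.RandomPlanarGeometry.CaratheodoryHalfPlaneProofs
import HarnessLib

/-!
# Chordal uniformizing maps of approximating Jordan domains converge (Radó)

Topic `Literature/Probability/RandomPlanarGeometry` (family `crit-ising`); theorems only (no
definition, no named fact). The domain-approximation input of Kemppainen–Smirnov's theorem for
curves in approximating domains (`DrivingProcessWeakLimitVarying.lean`, hypotheses (U1), (U2):
the boundary extensions `Φ_n` of chordal uniformizing maps `φ_n : ℍ → D_n` converge to that of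
`φ : ℍ → D` uniformly on the compacts of the closed half-plane and uniformly at infinity, with
`b_n → b`) from RADÓ'S THEOREM (T. Radó 1923; Ch. Pommerenke, *Boundary Behaviour of Conformal
Maps* (1992), §2.3 Thm. 2.11 — the tree's `JordanDomain.rado_tendstoUniformlyOn_holds`): if the
boundary loops of the Dobrushin domains `(D_n; a_n, b_n)` converge uniformly to that of
`(D; a, b)` and `a_n → a`, `b_n → b`, then chordal uniformizing maps normalised at a common
interior point converge uniformly on the WHOLE half-plane, hence (U1) on the whole closed
half-plane and (U2). This is the setting of Chelkak–Duminil-Copin–Hongler–Kemppainen–Smirnov,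
C. R. Math. 352 (2014), §3 ("a family of conformal maps `φ^δ` from `Ω^δ` onto `ℍ` … `φ^δ → φ`")
and of [LSW04] p. 977 ("`lim_{R → ∞} R⁻¹ φ_R⁻¹(z) = φ⁻¹(z)` uniformly in `ℍ̄` … from Cor. 2.4 in
[Pommerenke 1992]"), whose tree proof for the UST Peano approximations
(`USTPeano.tendstoUniformlyOn_inv_mul_of_forall`, `LSW2004USTRado.lean`) is followed here
verbatim for general Dobrushin domains.

* `exists_isChordalUniformizing_norm_symm_eq_one` — chordal uniformizing maps normalised by
  `|φ⁻¹(z₀)| = 1` at an interior point `z₀` exist (dilate any chordal uniformizing map);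
* **`tendstoUniformlyOn_of_tendstoUniformly_boundary`** — boundary loops converge uniformly,
  `a_n → a`, `b_n → b`, `z₀ ∈ D ∩ ⋂ D_n`, maps normalised by `|φ_n⁻¹(z₀)| = |φ⁻¹(z₀)| = 1`
  ⟹ `φ_n → φ` uniformly on `ℍ`. Proof ([LSW04] p. 977 / Pommerenke Cor. 2.4): Radó for the
  Carathéodory extensions `F_n → F` on `𝔻̄` of the Riemann maps `f_n : 𝔻 → D_n` normalised at
  `z₀`; `φ_n = F_n ∘ S_n` with `S_n = f_n⁻¹ ∘ φ_n : ℍ → 𝔻` conformal, `S_n(w_n) = 0`,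
  `w_n = φ_n⁻¹(z₀)`, `|w_n| = 1`, so `S_n(z) = μ_n (z - w_n)/(z - w̄_n)`, `|μ_n| = 1`
  (`ConformalEquiv.exists_eqOn_mul_moebius`); the boundary values give
  `F_n(μ_n w_n/w̄_n) = a_n → a = F(μ w/w̄)`, `F_n(μ_n) = b_n → b = F(μ)`, whence `μ_n → μ`,
  `w_n → w` (injectivity of `F` on `𝔻̄`), `S_n → S` uniformly on `ℍ`
  (`tendstoUniformlyOn_mul_moebius`) and `F_n ∘ S_n → F ∘ S` by uniform continuity of `F`;
* **`tendstoUniformlyOn_boundaryExtension_of_tendstoUniformly_boundary`** — the same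
  hypotheses give (U1) on the whole closed half-plane `{0 ≤ im}` (density,
  `tendstoUniformlyOn_of_subset_closure`) and (U2) (triangle inequality with `Φ z → b` at `∞`);
* `exists_uniformizers_of_tendstoUniformly_boundary` — packaged existence form for a point
  `z₀ ∈ D` lying in `D_n` for all large `n`: chordal uniformizing maps `φ_n`, `φ` with (U1), (U2)
  — exactly the hypotheses `hφs`, `hφ`, `hU1`, `hU2`, `hb` of
  `ae_isLoewnerDescribable_and_tendstoInDistribution_drivingPath_varying`.

## References

* Ch. Pommerenke, *Boundary Behaviour of Conformal Maps* (1992), §2.3 Thm. 2.11 (Radó), Cor. 2.4,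
  Thm. 2.6 (Carathéodory). [PommerenkeBBCM1992]
* G. F. Lawler, O. Schramm, W. Werner, Ann. Probab. 32 (2004), §4.3 p. 977. [LawlerSchrammWerner2004]
* D. Chelkak, H. Duminil-Copin, C. Hongler, A. Kemppainen, S. Smirnov, C. R. Math. Acad. Sci.
  Paris 352 (2014) 157–161, §3. [CDHKSCRAS2014]
* A. Kemppainen, S. Smirnov, Ann. Probab. 45 (2017), Cor. 1.8. [KemppainenSmirnov2017]
-/

noncomputable section

open Set Function Filter Metric Complex
open _root_.Topology
open UpperHalfPlane (upperHalfPlaneSet)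
open scoped ComplexConjugate

namespace Literature.Probability.RandomPlanarGeometry

namespace MarkedDomain

variable {D : DobrushinDomain} {Ds : ℕ → DobrushinDomain}

/-! ### Normalised chordal uniformizing maps -/

/-- **Chordal uniformizing maps normalised at an interior point exist**: for `z₀ ∈ D` there is a
chordal uniformizing map `φ` of `(D; a, b)` with `|φ⁻¹(z₀)| = 1` (dilate any chordal uniformizing
map, `IsChordalUniformizing.smul_trans`; [LSW04] p. 977: "`φ(a) = 0`, `φ(b) = ∞` and
`|φ(0)| = 1`"). [cite: LawlerSchrammWerner2004, §4.3] -/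
theorem exists_isChordalUniformizing_norm_symm_eq_one (D : DobrushinDomain) {z₀ : ℂ}
    (hz₀ : z₀ ∈ D.carrier) :
    ∃ φ : ConformalEquiv upperHalfPlaneSet D.carrier, D.IsChordalUniformizing φ ∧ ‖φ.symm z₀‖ = 1 := by
  obtain ⟨φ₀, hφ₀⟩ := exists_isChordalUniformizing_holds D
  set w : ℂ := φ₀.symm z₀ with hw
  have hwmem : w ∈ upperHalfPlaneSet := φ₀.symm_mapsTo hz₀
  have hw0 : w ≠ 0 := by
    intro h
    have : (0 : ℝ) < w.im := hwmem
    rw [h] at this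
    simp at this
  set c : ℝ := ‖w‖ with hc
  have hcpos : 0 < c := norm_pos_iff.2 hw0
  refine ⟨(ConformalEquiv.smulUpperHalfPlane c hcpos).trans φ₀, hφ₀.smul_trans c hcpos, ?_⟩
  set x : ℂ := c⁻¹ • w with hx
  have hxmem : x ∈ upperHalfPlaneSet := by
    show 0 < (c⁻¹ • w).im
    rw [Complex.smul_im, smul_eq_mul]
    exact mul_pos (inv_pos.2 hcpos) hwmem
  have hφx : ((ConformalEquiv.smulUpperHalfPlane c hcpos).trans φ₀) x = z₀ := by
    rw [ConformalEquiv.trans_apply, ConformalEquiv.smulUpperHalfPlane_apply, hx, smul_smul,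
      mul_inv_cancel₀ hcpos.ne', one_smul]
    exact φ₀.apply_symm_apply hz₀
  have hsymm : ((ConformalEquiv.smulUpperHalfPlane c hcpos).trans φ₀).symm z₀ = x := by
    rw [← hφx]
    exact ConformalEquiv.symm_apply_apply _ hxmem
  rw [hsymm, hx, norm_smul, norm_inv, Real.norm_of_nonneg hcpos.le, inv_mul_cancel₀ hcpos.ne']

/-! ### Radó: normalised chordal uniformizing maps converge uniformly on `ℍ` -/

/-- **Chordal uniformizing maps of approximating Jordan domains converge uniformly on `ℍ`**
([LSW04] p. 977 for general Dobrushin domains, via Radó's theorem = Pommerenke Thm. 2.11). Let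
the boundary loops of `(D_n; a_n, b_n)` converge uniformly to that of `(D; a, b)`, `a_n → a`,
`b_n → b`, let `z₀ ∈ D` lie in every `D_n`, and let `φ_n`, `φ` be chordal uniformizing maps
normalised by `|φ_n⁻¹(z₀)| = |φ⁻¹(z₀)| = 1`. Then `φ_n → φ` uniformly on `ℍ`. (Proof in the module
docstring.) [cite: PommerenkeBBCM1992, Thm. 2.11] [cite: LawlerSchrammWerner2004, §4.3] -/
theorem tendstoUniformlyOn_of_tendstoUniformly_boundary
    (hJ : TendstoUniformly (fun n ↦ (Ds n).boundary) D.boundary atTop)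
    (ha : Tendsto (fun n ↦ (Ds n).pt 0) atTop (𝓝 (D.pt 0)))
    (hb : Tendsto (fun n ↦ (Ds n).pt 1) atTop (𝓝 (D.pt 1)))
    {z₀ : ℂ} (hz₀ : z₀ ∈ D.carrier) (hz₀n : ∀ n, z₀ ∈ (Ds n).carrier)
    (φ : ConformalEquiv upperHalfPlaneSet D.carrier) (hφ : D.IsChordalUniformizing φ)
    (hφ1 : ‖φ.symm z₀‖ = 1)
    (φs : ∀ n, ConformalEquiv upperHalfPlaneSet (Ds n).carrier)
    (hφs : ∀ n, (Ds n).IsChordalUniformizing (φs n)) (hφs1 : ∀ n, ‖(φs n).symm z₀‖ = 1) :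
    TendstoUniformlyOn (fun n ↦ (φs n : ℂ → ℂ)) φ atTop upperHalfPlaneSet := by
  classical
  -- normalised Riemann maps and their inverses
  obtain ⟨ψl, hψl0, hψlre, hψlim⟩ := exists_conformalEquiv_ball_deriv_pos D.isOpen
    (JordanDomain.isSimplyConnected_holds D.toJordanDomain) D.carrier_ne_univ hz₀
  choose ψ hψ0 hψre hψim using fun n ↦ exists_conformalEquiv_ball_deriv_pos (Ds n).isOpen
    (JordanDomain.isSimplyConnected_holds (Ds n).toJordanDomain) (Ds n).carrier_ne_univ (hz₀n n)
  set f : ∀ n, ConformalEquiv (ball (0 : ℂ) 1) (Ds n).carrier := fun n ↦ (ψ n).symm with hf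
  set fl : ConformalEquiv (ball (0 : ℂ) 1) D.carrier := ψl.symm with hfl
  have hfl0' : fl 0 = z₀ := by
    have := ψl.symm_apply_apply hz₀
    rwa [hψl0] at this
  have hf0' : ∀ n, f n 0 = z₀ := fun n ↦ by
    have := (ψ n).symm_apply_apply (hz₀n n)
    rwa [hψ0 n] at this
  have hf0 : ∀ n, f n 0 = fl 0 := fun n ↦ by rw [hf0' n, hfl0']
  have hfd : ∀ n, 0 < (deriv (f n) 0).re ∧ (deriv (f n) 0).im = 0 := fun n ↦ by
    have h := (ψ n).deriv_symm_mul_deriv (Ds n).isOpen (hz₀n n)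
    rw [hψ0 n] at h
    exact Rado.re_pos_im_zero_of_mul_eq_one (hψre n) (hψim n) h
  have hfld : 0 < (deriv fl 0).re ∧ (deriv fl 0).im = 0 := by
    have h := ψl.deriv_symm_mul_deriv D.isOpen hz₀
    rw [hψl0] at h
    exact Rado.re_pos_im_zero_of_mul_eq_one hψlre hψlim h
  -- Radó's theorem for the Carathéodory extensions
  choose Φ hΦc hΦeq hΦbij hΦsph using
    fun n ↦ JordanDomain.exists_continuousOn_extension_holds (Ds n).toJordanDomain (f n)
  obtain ⟨Φl, hΦlc, hΦleq, hΦlbij, hΦlsph⟩ :=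
    JordanDomain.exists_continuousOn_extension_holds D.toJordanDomain fl
  have hrado : TendstoUniformlyOn Φ Φl atTop (closedBall (0 : ℂ) 1) :=
    JordanDomain.rado_tendstoUniformlyOn.closedBall JordanDomain.rado_tendstoUniformlyOn_holds
      (fun n ↦ (Ds n).toJordanDomain) D.toJordanDomain f fl hf0 hfd hfld hJ Φ Φl hΦc hΦeq hΦlc hΦleq
  -- the conformal maps `Sₙ = ψₙ ∘ φₙ : ℍ → 𝔻`, `S = ψ ∘ φ`
  set S : ∀ n, ConformalEquiv upperHalfPlaneSet (ball (0 : ℂ) 1) := fun n ↦ (φs n).trans (ψ n)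
    with hS
  set Sl : ConformalEquiv upperHalfPlaneSet (ball (0 : ℂ) 1) := φ.trans ψl with hSl
  -- the normalisation: `Sₙ(wₙ) = 0`, `wₙ = φₙ⁻¹(z₀)`, `|wₙ| = 1`
  set w : ℕ → ℂ := fun n ↦ (φs n).symm z₀ with hw
  set wl : ℂ := φ.symm z₀ with hwl
  have hwmem : ∀ n, w n ∈ upperHalfPlaneSet := fun n ↦ (φs n).symm_mapsTo (hz₀n n)
  have hwlmem : wl ∈ upperHalfPlaneSet := φ.symm_mapsTo hz₀
  have hwnorm : ∀ n, ‖w n‖ = 1 := hφs1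
  have hSw : ∀ n, S n (w n) = 0 := fun n ↦ by
    rw [hS, ConformalEquiv.trans_apply,
      show φs n (w n) = z₀ from (φs n).apply_symm_apply (hz₀n n), hψ0 n]
  have hSlw : Sl wl = 0 := by
    rw [hSl, ConformalEquiv.trans_apply, show φ wl = z₀ from φ.apply_symm_apply hz₀, hψl0]
  choose μ hμ1 hSμ using fun n ↦ (S n).exists_eqOn_mul_moebius (hwmem n) (hSw n)
  obtain ⟨μl, hμl1, hSlμ⟩ := Sl.exists_eqOn_mul_moebius hwlmem hSlw
  -- the factorisations `φₙ = Φₙ ∘ Sₙ`, `φ = Φ ∘ S` on `ℍ`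
  have hkey : ∀ n, ∀ z ∈ upperHalfPlaneSet, φs n z = Φ n (S n z) := fun n z hz ↦ by
    have hmem : S n z ∈ ball (0 : ℂ) 1 := (S n).mapsTo hz
    rw [hΦeq n hmem, hS, ConformalEquiv.trans_apply]
    exact ((ψ n).symm_apply_apply ((φs n).mapsTo hz)).symm
  have hkeyl : ∀ z ∈ upperHalfPlaneSet, φ z = Φl (Sl z) := fun z hz ↦ by
    have hmem : Sl z ∈ ball (0 : ℂ) 1 := Sl.mapsTo hz
    rw [hΦleq hmem, hSl, ConformalEquiv.trans_apply]
    exact (ψl.symm_apply_apply (φ.mapsTo hz)).symm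
  -- the boundary points `ζₙ = μₙ wₙ/w̄ₙ` (image of `0`) and `μₙ` (image of `∞`)
  haveI : NeBot (𝓝[upperHalfPlaneSet] (0 : ℂ)) := neBot_nhdsWithin_upperHalfPlaneSet_zero
  haveI : NeBot (cocompact ℂ ⊓ 𝓟 upperHalfPlaneSet) := neBot_cocompact_inf_principal_upperHalfPlaneSet
  set ζ : ℕ → ℂ := fun n ↦ μ n * (w n / conj (w n)) with hζ
  set ζl : ℂ := μl * (wl / conj wl) with hζl
  have hζmem : ∀ n, ζ n ∈ closedBall (0 : ℂ) 1 := fun n ↦ by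
    rw [mem_closedBall_zero_iff, hζ]
    simp only [norm_mul, hμ1 n, USTPeano.norm_div_conj (hwnorm n), mul_one, le_refl]
  have hwlnorm : ‖wl‖ = 1 := hφ1
  have hζlmem : ζl ∈ closedBall (0 : ℂ) 1 := by
    rw [mem_closedBall_zero_iff, hζl, norm_mul, hμl1, USTPeano.norm_div_conj hwlnorm, mul_one]
  have hμmem : ∀ n, μ n ∈ closedBall (0 : ℂ) 1 := fun n ↦ by
    rw [mem_closedBall_zero_iff, hμ1 n]
  have hμlmem : μl ∈ closedBall (0 : ℂ) 1 := by rw [mem_closedBall_zero_iff, hμl1]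
  -- boundary values through the factorisation
  have hbv0 : ∀ {n : ℕ} {p : ℂ}, Tendsto (φs n) (𝓝[upperHalfPlaneSet] 0) (𝓝 p) →
      Φ n (ζ n) = p := by
    intro n p hp
    have hS' : Tendsto (S n) (𝓝[upperHalfPlaneSet] 0) (𝓝[closedBall 0 1] (ζ n)) := by
      refine tendsto_nhdsWithin_iff.2 ⟨?_, ?_⟩
      · exact (USTPeano.tendsto_mul_moebius_nhdsWithin_zero (hwmem n) (μ n)).congr'
          (eventually_nhdsWithin_of_forall fun z hz ↦ (hSμ n hz).symm)
      · exact eventually_nhdsWithin_of_forall fun z hz ↦ ball_subset_closedBall ((S n).mapsTo hz)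
    have h2 : Tendsto (φs n) (𝓝[upperHalfPlaneSet] 0) (𝓝 (Φ n (ζ n))) :=
      (((hΦc n) (ζ n) (hζmem n)).tendsto.comp hS').congr'
        (eventually_nhdsWithin_of_forall fun z hz ↦ (hkey n z hz).symm)
    exact tendsto_nhds_unique h2 hp
  have hbvinf : ∀ {n : ℕ} {p : ℂ}, Tendsto (φs n) (cocompact ℂ ⊓ 𝓟 upperHalfPlaneSet) (𝓝 p) →
      Φ n (μ n) = p := by
    intro n p hp
    have hS' : Tendsto (S n) (cocompact ℂ ⊓ 𝓟 upperHalfPlaneSet) (𝓝[closedBall 0 1] (μ n)) := by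
      refine tendsto_nhdsWithin_iff.2 ⟨?_, ?_⟩
      · exact (USTPeano.tendsto_mul_moebius_cocompact (hwmem n) (μ n)).congr'
          (eventually_inf_principal.2 (Eventually.of_forall fun z hz ↦ (hSμ n hz).symm))
      · exact eventually_inf_principal.2
          (Eventually.of_forall fun z hz ↦ ball_subset_closedBall ((S n).mapsTo hz))
    have h2 : Tendsto (φs n) (cocompact ℂ ⊓ 𝓟 upperHalfPlaneSet) (𝓝 (Φ n (μ n))) :=
      (((hΦc n) (μ n) (hμmem n)).tendsto.comp hS').congr'
        (eventually_inf_principal.2 (Eventually.of_forall fun z hz ↦ (hkey n z hz).symm))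
    exact tendsto_nhds_unique h2 hp
  have hΦζ : ∀ n, Φ n (ζ n) = (Ds n).pt 0 := fun n ↦ hbv0 (hφs n).1
  have hΦμ : ∀ n, Φ n (μ n) = (Ds n).pt 1 := fun n ↦ hbvinf (hφs n).2
  -- the same for the limit map
  have hΦlζ : Φl ζl = D.pt 0 := by
    have h1 : Tendsto φ (𝓝[upperHalfPlaneSet] 0) (𝓝 (D.pt 0)) := hφ.1
    have hS' : Tendsto Sl (𝓝[upperHalfPlaneSet] 0) (𝓝[closedBall 0 1] ζl) := by
      refine tendsto_nhdsWithin_iff.2 ⟨?_, ?_⟩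
      · exact (USTPeano.tendsto_mul_moebius_nhdsWithin_zero hwlmem μl).congr'
          (eventually_nhdsWithin_of_forall fun z hz ↦ (hSlμ hz).symm)
      · exact eventually_nhdsWithin_of_forall fun z hz ↦ ball_subset_closedBall (Sl.mapsTo hz)
    have h2 : Tendsto φ (𝓝[upperHalfPlaneSet] 0) (𝓝 (Φl ζl)) :=
      ((hΦlc ζl hζlmem).tendsto.comp hS').congr'
        (eventually_nhdsWithin_of_forall fun z hz ↦ (hkeyl z hz).symm)
    exact tendsto_nhds_unique h2 h1
  have hΦlμ : Φl μl = D.pt 1 := by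
    have h1 : Tendsto φ (cocompact ℂ ⊓ 𝓟 upperHalfPlaneSet) (𝓝 (D.pt 1)) := hφ.2
    have hS' : Tendsto Sl (cocompact ℂ ⊓ 𝓟 upperHalfPlaneSet) (𝓝[closedBall 0 1] μl) := by
      refine tendsto_nhdsWithin_iff.2 ⟨?_, ?_⟩
      · exact (USTPeano.tendsto_mul_moebius_cocompact hwlmem μl).congr'
          (eventually_inf_principal.2 (Eventually.of_forall fun z hz ↦ (hSlμ hz).symm))
      · exact eventually_inf_principal.2
          (Eventually.of_forall fun z hz ↦ ball_subset_closedBall (Sl.mapsTo hz))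
    have h2 : Tendsto φ (cocompact ℂ ⊓ 𝓟 upperHalfPlaneSet) (𝓝 (Φl μl)) :=
      ((hΦlc μl hμlmem).tendsto.comp hS').congr'
        (eventually_inf_principal.2 (Eventually.of_forall fun z hz ↦ (hkeyl z hz).symm))
    exact tendsto_nhds_unique h2 h1
  -- hence `ζₙ → ζ`, `μₙ → μ` (injectivity of `Φ` on the closed disc)
  have hΦlinj : InjOn Φl (closedBall 0 1) := hΦlbij.injOn
  have hunif : ∀ {x : ℕ → ℂ}, (∀ n, x n ∈ closedBall (0 : ℂ) 1) →
      Tendsto (fun n ↦ dist (Φ n (x n)) (Φl (x n))) atTop (𝓝 0) := by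
    intro x hx
    rw [Metric.tendsto_nhds]
    intro ε hε
    filter_upwards [Metric.tendstoUniformlyOn_iff.1 hrado ε hε] with n hn
    rw [Real.dist_eq, sub_zero, abs_of_nonneg dist_nonneg, dist_comm]
    exact hn (x n) (hx n)
  have hζlim : Tendsto ζ atTop (𝓝 ζl) := by
    refine tendsto_of_injOn_of_tendsto_comp (isCompact_closedBall 0 1) hΦlc hΦlinj
      (Eventually.of_forall hζmem) hζlmem ?_
    rw [hΦlζ]
    have h1 : Tendsto (fun n ↦ Φ n (ζ n)) atTop (𝓝 (D.pt 0)) := ha.congr fun n ↦ (hΦζ n).symm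
    exact h1.congr_dist (hunif hζmem)
  have hμlim : Tendsto μ atTop (𝓝 μl) := by
    refine tendsto_of_injOn_of_tendsto_comp (isCompact_closedBall 0 1) hΦlc hΦlinj
      (Eventually.of_forall hμmem) hμlmem ?_
    rw [hΦlμ]
    have h1 : Tendsto (fun n ↦ Φ n (μ n)) atTop (𝓝 (D.pt 1)) := hb.congr fun n ↦ (hΦμ n).symm
    exact h1.congr_dist (hunif hμmem)
  -- hence `wₙ → w` (`wₙ² = ζₙ/μₙ → ζ/μ = w²`, and `|wₙ - w| Im w ≤ |wₙ² - w²|`)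
  have hμne : ∀ n, μ n ≠ 0 := fun n ↦ by rw [← norm_ne_zero_iff, hμ1 n]; exact one_ne_zero
  have hμlne : μl ≠ 0 := by rw [← norm_ne_zero_iff, hμl1]; exact one_ne_zero
  have hwlim : Tendsto w atTop (𝓝 wl) := by
    have hsq : Tendsto (fun n ↦ w n ^ 2) atTop (𝓝 (wl ^ 2)) := by
      have h1 : Tendsto (fun n ↦ ζ n / μ n) atTop (𝓝 (ζl / μl)) := hζlim.div hμlim hμlne
      have e1 : ∀ n, ζ n / μ n = w n ^ 2 := fun n ↦ by
        rw [hζ]; simp only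
        rw [mul_div_cancel_left₀ _ (hμne n), USTPeano.div_conj_eq_sq (hwnorm n)]
      have e2 : ζl / μl = wl ^ 2 := by
        rw [hζl, mul_div_cancel_left₀ _ hμlne, USTPeano.div_conj_eq_sq hwlnorm]
      rw [← e2]
      exact h1.congr e1
    have hwlim' : 0 < wl.im := hwlmem
    rw [Metric.tendsto_nhds] at hsq ⊢
    intro ε hε
    filter_upwards [hsq (ε * wl.im) (by positivity)] with n hn
    have hsum : wl.im ≤ ‖w n + wl‖ := by
      calc wl.im ≤ (w n).im + wl.im := by linarith [(show 0 < (w n).im from hwmem n).le]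
        _ = (w n + wl).im := by simp
        _ ≤ |(w n + wl).im| := le_abs_self _
        _ ≤ ‖w n + wl‖ := Complex.abs_im_le_norm _
    have hprod : ‖w n - wl‖ * ‖w n + wl‖ = dist (w n ^ 2) (wl ^ 2) := by
      rw [← norm_mul, dist_eq_norm]; congr 1; ring
    rw [dist_eq_norm]
    by_contra hge
    rw [not_lt] at hge
    have : ε * wl.im ≤ ‖w n - wl‖ * ‖w n + wl‖ :=
      mul_le_mul hge hsum hwlim'.le (norm_nonneg _)
    linarith
  -- `Sₙ → S` uniformly on `ℍ`, and the conclusion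
  have hT := tendstoUniformlyOn_mul_moebius hwlmem hwlim hμlim (fun n ↦ (hμ1 n).le)
  rw [Metric.tendstoUniformlyOn_iff]
  intro ε hε
  obtain ⟨δ, hδ, hδΦ⟩ := Metric.uniformContinuousOn_iff.1
    ((isCompact_closedBall (0 : ℂ) 1).uniformContinuousOn_of_continuous hΦlc) (ε / 2) (half_pos hε)
  filter_upwards [Metric.tendstoUniformlyOn_iff.1 hrado (ε / 2) (half_pos hε),
    Metric.tendstoUniformlyOn_iff.1 hT δ hδ] with n hn1 hn2 z hz
  have hSz : S n z ∈ closedBall (0 : ℂ) 1 := ball_subset_closedBall ((S n).mapsTo hz)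
  have hSlz : Sl z ∈ closedBall (0 : ℂ) 1 := ball_subset_closedBall (Sl.mapsTo hz)
  have hd : dist (Sl z) (S n z) < δ := by
    rw [hSlμ hz, hSμ n hz]
    exact hn2 z hz
  rw [hkeyl z hz, hkey n z hz]
  calc dist (Φl (Sl z)) (Φ n (S n z))
      ≤ dist (Φl (Sl z)) (Φl (S n z)) + dist (Φl (S n z)) (Φ n (S n z)) := dist_triangle _ _ _
    _ < ε / 2 + ε / 2 := add_lt_add (hδΦ _ hSlz _ hSz hd) (hn1 _ hSz)
    _ = ε := by ring

/-! ### (U1) on the closed half-plane and (U2) -/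

/-- **The boundary extensions converge uniformly on the closed half-plane, and uniformly at
infinity** — the hypotheses (U1) (here on all of `{0 ≤ im}`, in particular on its compacts) and
(U2) of `ae_isLoewnerDescribable_and_tendstoInDistribution_drivingPath_varying`, under the
hypotheses of `tendstoUniformlyOn_of_tendstoUniformly_boundary`. (U1): uniform convergence on
`ℍ` passes to the continuous extensions on its closure (`tendstoUniformlyOn_of_subset_closure`);
(U2): `dist (Φ_n z) b_n ≤ dist (Φ_n z) (Φ z) + dist (Φ z) b + dist b b_n` with `Φ z → b` at
`∞` (`IsChordalUniformizing.tendsto_boundaryExtension_cocompact`).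
[cite: PommerenkeBBCM1992, Thm. 2.11] [cite: KemppainenSmirnov2017, Cor. 1.8] -/
theorem tendstoUniformlyOn_boundaryExtension_of_tendstoUniformly_boundary
    (hJ : TendstoUniformly (fun n ↦ (Ds n).boundary) D.boundary atTop)
    (ha : Tendsto (fun n ↦ (Ds n).pt 0) atTop (𝓝 (D.pt 0)))
    (hb : Tendsto (fun n ↦ (Ds n).pt 1) atTop (𝓝 (D.pt 1)))
    {z₀ : ℂ} (hz₀ : z₀ ∈ D.carrier) (hz₀n : ∀ n, z₀ ∈ (Ds n).carrier)
    (φ : ConformalEquiv upperHalfPlaneSet D.carrier) (hφ : D.IsChordalUniformizing φ)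
    (hφ1 : ‖φ.symm z₀‖ = 1)
    (φs : ∀ n, ConformalEquiv upperHalfPlaneSet (Ds n).carrier)
    (hφs : ∀ n, (Ds n).IsChordalUniformizing (φs n)) (hφs1 : ∀ n, ‖(φs n).symm z₀‖ = 1) :
    TendstoUniformlyOn (fun n ↦ (φs n).boundaryExtension) φ.boundaryExtension atTop
        {z : ℂ | 0 ≤ z.im} ∧
      ∀ ε : ℝ, 0 < ε → ∃ r : ℝ, ∀ᶠ n in atTop, ∀ z : ℂ, z ∈ {z : ℂ | 0 ≤ z.im} → r ≤ ‖z‖ →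
        dist ((φs n).boundaryExtension z) ((Ds n).pt 1) ≤ ε := by
  have hopen : TendstoUniformlyOn (fun n ↦ (φs n).boundaryExtension) φ.boundaryExtension atTop
      upperHalfPlaneSet := by
    have h := tendstoUniformlyOn_of_tendstoUniformly_boundary hJ ha hb hz₀ hz₀n φ hφ hφ1 φs hφs hφs1
    refine (h.congr (Eventually.of_forall fun n z hz ↦ ((φs n).boundaryExtension_eq hz).symm)).congr_right
      fun z hz ↦ (φ.boundaryExtension_eq hz).symm
  have hA : closure upperHalfPlaneSet = {z : ℂ | 0 ≤ z.im} := ConformalEquiv.closure_upperHalfPlaneSet_eq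
  have hst : {z : ℂ | 0 ≤ z.im} ⊆ closure upperHalfPlaneSet := by rw [hA]
  have hsub : upperHalfPlaneSet ⊆ {z : ℂ | 0 ≤ z.im} := fun z (hz : 0 < z.im) ↦ hz.le
  have hcont : ∀ {E : DobrushinDomain} (ψ : ConformalEquiv upperHalfPlaneSet E.carrier),
      ContinuousOn ψ.boundaryExtension {z : ℂ | 0 ≤ z.im} := by
    intro E ψ
    rw [← hA]
    exact JordanDomain.continuousOn_boundaryExtension_holds E.toJordanDomain ψ
  have hU1 : TendstoUniformlyOn (fun n ↦ (φs n).boundaryExtension) φ.boundaryExtension atTop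
      {z : ℂ | 0 ≤ z.im} :=
    tendstoUniformlyOn_of_subset_closure hst hsub (Eventually.of_forall fun n ↦ hcont (φs n))
      (hcont φ) hopen
  refine ⟨hU1, fun ε hε ↦ ?_⟩
  -- `Φ z → b` at infinity
  have hfar : ∃ r : ℝ, ∀ z : ℂ, 0 ≤ z.im → r ≤ ‖z‖ → dist (φ.boundaryExtension z) (D.pt 1) < ε / 3 := by
    have h' : ∀ᶠ z in cocompact ℂ ⊓ 𝓟 {z : ℂ | 0 ≤ z.im},
        dist (φ.boundaryExtension z) (D.pt 1) < ε / 3 :=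
      Metric.tendsto_nhds.1 (IsChordalUniformizing.tendsto_boundaryExtension_cocompact hφ) _
        (by positivity)
    rw [(hasBasis_cocompact.inf_principal _).eventually_iff] at h'
    obtain ⟨K, hK, hKε⟩ := h'
    obtain ⟨R, hR⟩ := hK.isBounded.subset_closedBall 0
    refine ⟨R + 1, fun z hzim hz ↦ hKε ⟨fun hzK ↦ ?_, hzim⟩⟩
    have := mem_closedBall_zero_iff.1 (hR hzK)
    linarith
  obtain ⟨r, hr⟩ := hfar
  refine ⟨r, ?_⟩
  filter_upwards [Metric.tendstoUniformlyOn_iff.1 hU1 (ε / 3) (by positivity),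
    Metric.tendsto_nhds.1 hb (ε / 3) (by positivity)] with n hn1 hn2 z hz hzr
  have h1 := hn1 z hz
  have h2 := hr z hz hzr
  have h3 : dist ((Ds n).pt 1) (D.pt 1) < ε / 3 := hn2
  calc dist ((φs n).boundaryExtension z) ((Ds n).pt 1)
      ≤ dist ((φs n).boundaryExtension z) (φ.boundaryExtension z) +
          dist (φ.boundaryExtension z) (D.pt 1) + dist (D.pt 1) ((Ds n).pt 1) :=
        dist_triangle4 _ _ _ _
    _ ≤ ε := by rw [dist_comm ((φs n).boundaryExtension z), dist_comm (D.pt 1)]; linarith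

/-! ### Packaged existence form -/

/-- **Chordal uniformizing maps with (U1), (U2) exist for approximating Jordan domains.** If the
boundary loops of `(D_n; a_n, b_n)` converge uniformly to that of `(D; a, b)`, `a_n → a`,
`b_n → b`, and some point `z₀ ∈ D` lies in `D_n` for all large `n`, then there are chordal
uniformizing maps `φ_n` of `(D_n; a_n, b_n)` and `φ` of `(D; a, b)` whose boundary extensions
converge uniformly on the closed half-plane and uniformly at infinity — the hypotheses `hφ`,
`hφs`, `hU1`, `hU2`, `hb` of `ae_isLoewnerDescribable_and_tendstoInDistribution_drivingPath_varying`
(`DrivingProcessWeakLimitVarying.lean`). The finitely many `n` with `z₀ ∉ D_n` receive arbitrary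
chordal uniformizing maps (`MarkedDomain.exists_isChordalUniformizing_holds`).
[cite: PommerenkeBBCM1992, Thm. 2.11] [cite: KemppainenSmirnov2017, Cor. 1.8]
[cite: CDHKSCRAS2014, §3] -/
theorem exists_uniformizers_of_tendstoUniformly_boundary
    (hJ : TendstoUniformly (fun n ↦ (Ds n).boundary) D.boundary atTop)
    (ha : Tendsto (fun n ↦ (Ds n).pt 0) atTop (𝓝 (D.pt 0)))
    (hb : Tendsto (fun n ↦ (Ds n).pt 1) atTop (𝓝 (D.pt 1)))
    {z₀ : ℂ} (hz₀ : z₀ ∈ D.carrier) (hz₀n : ∀ᶠ n in atTop, z₀ ∈ (Ds n).carrier) :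
    ∃ (φ : ConformalEquiv upperHalfPlaneSet D.carrier)
      (φs : ∀ n, ConformalEquiv upperHalfPlaneSet (Ds n).carrier),
      D.IsChordalUniformizing φ ∧ (∀ n, (Ds n).IsChordalUniformizing (φs n)) ∧
      TendstoUniformlyOn (fun n ↦ (φs n).boundaryExtension) φ.boundaryExtension atTop
        {z : ℂ | 0 ≤ z.im} ∧
      (∀ R : ℝ, TendstoUniformlyOn (fun n ↦ (φs n).boundaryExtension) φ.boundaryExtension atTop
        ({z : ℂ | 0 ≤ z.im} ∩ closedBall 0 R)) ∧
      ∀ ε : ℝ, 0 < ε → ∃ r : ℝ, ∀ᶠ n in atTop, ∀ z : ℂ, z ∈ {z : ℂ | 0 ≤ z.im} → r ≤ ‖z‖ →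
        dist ((φs n).boundaryExtension z) ((Ds n).pt 1) ≤ ε := by
  classical
  obtain ⟨N₀, hN₀⟩ := eventually_atTop.1 hz₀n
  obtain ⟨φ, hφ, hφ1⟩ := exists_isChordalUniformizing_norm_symm_eq_one D hz₀
  -- normalised maps for the good indices, arbitrary ones elsewhere
  have hgood : ∀ n, ∃ ψ : ConformalEquiv upperHalfPlaneSet (Ds n).carrier,
      (Ds n).IsChordalUniformizing ψ ∧ (N₀ ≤ n → ‖ψ.symm z₀‖ = 1) := by
    intro n
    by_cases hn : N₀ ≤ n
    · obtain ⟨ψ, hψ, hψ1⟩ := exists_isChordalUniformizing_norm_symm_eq_one (Ds n) (hN₀ n hn)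
      exact ⟨ψ, hψ, fun _ ↦ hψ1⟩
    · obtain ⟨ψ, hψ⟩ := exists_isChordalUniformizing_holds (Ds n)
      exact ⟨ψ, hψ, fun h ↦ (hn h).elim⟩
  choose φs hφs hφs1 using hgood
  -- the shifted sequence satisfies the hypotheses of the main theorem
  have hJ' : TendstoUniformly (fun n ↦ (Ds (n + N₀)).boundary) D.boundary atTop := by
    rw [Metric.tendstoUniformly_iff] at hJ ⊢
    exact fun ε hε ↦ (tendsto_add_atTop_nat N₀).eventually (hJ ε hε)
  have hshift := tendstoUniformlyOn_boundaryExtension_of_tendstoUniformly_boundary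
    (Ds := fun n ↦ Ds (n + N₀)) hJ'
    (ha.comp (tendsto_add_atTop_nat N₀)) (hb.comp (tendsto_add_atTop_nat N₀)) hz₀
    (fun n ↦ hN₀ (n + N₀) (Nat.le_add_left _ _)) φ hφ hφ1 (fun n ↦ φs (n + N₀))
    (fun n ↦ hφs (n + N₀)) (fun n ↦ hφs1 (n + N₀) (Nat.le_add_left _ _))
  obtain ⟨hU1', hU2'⟩ := hshift
  have hU1 : TendstoUniformlyOn (fun n ↦ (φs n).boundaryExtension) φ.boundaryExtension atTop
      {z : ℂ | 0 ≤ z.im} := by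
    rw [Metric.tendstoUniformlyOn_iff] at hU1' ⊢
    intro ε hε
    have h2 : ∀ᶠ n in Filter.map (fun n ↦ n + N₀) atTop,
        ∀ x ∈ {z : ℂ | 0 ≤ z.im}, dist (φ.boundaryExtension x) ((φs n).boundaryExtension x) < ε :=
      Filter.eventually_map.2 (hU1' ε hε)
    rwa [Filter.map_add_atTop_eq_nat N₀] at h2
  refine ⟨φ, φs, hφ, hφs, hU1, fun R ↦ hU1.mono inter_subset_left, fun ε hε ↦ ?_⟩
  obtain ⟨r, hr⟩ := hU2' ε hε
  refine ⟨r, ?_⟩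
  have h2 : ∀ᶠ n in Filter.map (fun n ↦ n + N₀) atTop, ∀ z : ℂ, z ∈ {z : ℂ | 0 ≤ z.im} →
      r ≤ ‖z‖ → dist ((φs n).boundaryExtension z) ((Ds n).pt 1) ≤ ε :=
    Filter.eventually_map.2 hr
  rwa [Filter.map_add_atTop_eq_nat N₀] at h2

end MarkedDomain

end Literature.Probability.RandomPlanarGeometry
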